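import Summits.QuantumFields.BalabanUV.Beta.D1BFx.RankOneBubble
import Summits.QuantumFields.BalabanUV.Beta.D1BFx.RJetAssembly

/-!
# `BalabanUV.Beta.D1BFx.RankOneBubbleJets` — road «BF-x» for binder row D1, slot (K), END row `hGrp gN`, «GN-𝔅» PART 2 (`D = 4`): THE GAUGE-TERM
# STENCILS AS RANK-ONE BOND KERNELS — `dSw (f ⊗ g) = ∇f ⊗ ∇g`, `dJetSw κ u Y = (∇Y(·,u+e_κ)) ⊗ δ_{(u,κ)} − δ_{(u,κ)} ⊗ (∇Y(u+e_κ,·))` — AND THE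
# WORD SHAPES OF THE GLUON NEEDLE ROWS: `bubble (dSw⊗dSw) = ⟨∇g, A∇f′⟩·⟨A∇f, ∇g′⟩`, `dSw ⊗ dJetSw` (a point value of `A∇f`), `dJetSw ⊗ dJetSw`
# (two point values, one entry of the leg, two pairings) — an3-g57 `N36-SPLIT.v1.md` §3′ (1)∕(4) typed, over PART 1 `RankOneBubble`

HONEST DEPENDENCY (cell records, verbatim): «continuum YM on T⁴ ⇐ BetaPertH ∧ nine spine estimates (0/9 proved); BetaPertH ⇐ (D1) ∧ (D4) ∧
CAP+tail; G-an2-4 gates asym, D1 and NE2/3/4.»  HONEST FRAMING (cell contract, verbatim): «discharging `BetaPertH` makes Bałaban's UV stability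
UNCONDITIONAL — a real constructive-QFT result; it is NOT the continuum limit and NOT the Clay problem.»  THIS MODULE DISCHARGES NOTHING of the
wall: definitions with bodies ([our objects] `grad`, `bondInd`, `tensor`, `colGrad`, `rowGrad` — names for the lattice gradient of a site function,
the bond indicator `δ_{(u,κ)}`, the tensor product of two site functions as a `Unit`-fibred kernel (the entry function of `SbRblkAnatomy.dSw_rankOne`),
and the column∕row gradients of a site kernel) and [folklore] algebra BY NAME over PART 1 (`RankOneBubble.biBubble_outer_outer`, hypothesis-free;
`loc_outer`, `bubble_outer_sub_left∕right` under `Spr`∕`Loc`) and leaf-05-g3's `RJetAssembly.dSw`∕`dJetSw`.  No `def … : Prop`, nothing cited,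
0 sorry.  Asserts NO bound on any table.  Root-level binders hW ∕ hR-sockets ∕ hSX-socket ∕ D1Tel ∕ D1Rep — 0 discharged; (K) NOT closed; NOT D1,
NOT `BetaPertH`, NOT continuum, NOT Clay.

ABSOLUTE RULE (cell charter, verbatim): «No internally-minted statement may enter as a cited fact. Every hypothesis is either kernel-proved in
this package or a verbatim quotation of a PUBLISHED theorem with page reference. The manuscript(s) under audit are NOT citable for their own
disputed steps — they are the thing under adjudication; programme-internal (2001/route/tribunal) claims are never citable.»

WHY (owner `GLUON-NEEDLE-ROWS.md` v0.1 + RULING ρ-g9-33; an3-g57 §3′ (1) «for `Y = Σ_j a_j⊗b_j`, `Y′ = Σ_i a′_i⊗b′_i` (site functions),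
`tr((Ga∘dSw Y′)∘(Ga∘dSw Y)) = Σ_{i,j} 𝔅(b′_i, a_j)·𝔅(b_j, a′_i)`, `𝔅(f,h) := ⟨∇f, Ga ∇h⟩`», §3′ (4) «R1⊗R1: `tr = ⟨e′,Ga g⟩⟨e,Ga g′⟩ −
Ga(u′μ;uν)·⟨g,Ga g′⟩ − (transposes)`»).  The projector sector of the gluon needle rows is `SbRblk = cK • dipPiece + ndlPiece − projPiece`
(`GluonNeedleSplit.SbRblk_eq_pieces`) with `dipPiece`, `ndlPiece` of the form `dSw (Σ ± tensor · ·)` (`SbRblkAnatomy.SbRblk_apply_road`: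
`Rdot = cK·(ρ′⊗p − ρ⊗p′ − p⊗ρ′ + p′⊗ρ) − row⊗C + C⊗row`) and `projPiece = dJetSw κ u (Pgt)`.  PART 1 proved that the bubble of two rank-one bond
kernels is a product of two pairings with NO hypothesis; this file identifies the gauge-term stencils as (differences of) rank-one bond kernels and
writes out the resulting WORD SHAPES, so that the row files «GN-P»∕«GN-K»∕«GN-Q»∕«GN-33» only have to bound pairings `⟨∇h, Ga ∇f⟩`, point values
`(Ga ∇f)(u,κ)` and entries of `Ga` by the letters (L1)–(L5) (leaf-05's needle-potential profiles, leaf-04-g9's lattice HLS kit).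

CONTENT (`D = 4`; legs `A B : MKer 4 (Fin 4)`, site kernels `Y : MKer 4 Unit`).
* §3a (any `D`) [folklore] `tadpole_outer : tadpole A (outer φ ψ) = pairing (applyK A φ) ψ` (no hypothesis).
* §3 [our objects] `grad`, `bondInd`, `tensor`, `colGrad`, `rowGrad`; [folklore] **`dSw_tensor`** (`dSw (tensor f g) = outer (grad f) (grad g)`),
  **`dJetSw_eq_outer_sub`**, `pairing_bondInd_left∕right`, `applyK_bondInd`, `applyKT_bondInd`, `pairing_applyK_bondInd(_left)` (pairing a bond
  indicator = evaluation; a leg on a bond indicator = its column∕row), `locV_bondInd`, **`locV_grad`** (+ `locV_grad_of_locV`, `locV_colGrad`,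
  `locV_rowGrad`, `loc_dSw_tensor`).
* §4 [folklore] the word shapes: **`biBubble_dSw_dSw`** ∕ `bubble_dSw_dSw` (any legs, no hypothesis), the four indicator placements
  `biBubble_dSw_outer_bondInd_right∕left`, `biBubble_outer_bondInd_outer_bondInd`, `biBubble_outer_bondInd_bondInd_outer`,
  `biBubble_bondInd_outer_outer_bondInd`, `biBubble_bondInd_outer_bondInd_outer` (no hypothesis), and over ONE SPREAD LEG with a spread partner kernel
  **`bubble_dSw_dJetSw`**, **`bubble_dJetSw_dJetSw`**.
NOT HERE (honest): any estimate; the identification of the road's `row`, `C`, `D` (= `SbRblk_apply_road`); the expansion of a specific T-row (the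
row files do it with PART 1's `outer_*` algebra + `bubble_add∕sub_left∕right`).
Unit `b2b-balaban-beta-d1-p2` (gen 10), road «BF-x» OWNER; `LEAVES-BFx.md` row (N) «GN-𝔅» PART 2.
-/

noncomputable section

namespace Summit.QuantumFields.BalabanUV.Beta.D1BFx.RankOneBubbleJets

open Finset
open scoped BigOperators
open Literature.MathematicalPhysics.QuantumFieldTheory.Balaban1983to89
open Literature.MathematicalPhysics.QuantumFieldTheory.Balaban1983to89.Beta
open B12Sec2to5 (l1 l1_nonneg)
open ExpKernelCalculus (Site MKer Decays BiLoc comp tr bubble tadpole l1_sub_triangle l1_sub_symm)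
open Summit.QuantumFields.BalabanUV.Beta.TameKernelCalculus (Spr Loc)
open Summit.QuantumFields.BalabanUV.Beta.D1BFx.PackedKernelSplit (biBubble bubble_eq_biBubble)
open Summit.QuantumFields.BalabanUV.Beta.D1BFx.RankOneBubble
open AffineAveraging (unitVec)
open Summit.QuantumFields.BalabanUV.Beta.D1BFx.RJetAssembly (dSw dSw_apply dJetSw dJetSw_apply)

/-! ## §3a (any `D`) The tadpole of a rank-one table is ONE pairing (the T₈-type words: `WQ = 2a·Q̇*Q̇|_ff` is a sum of rank-one tables) -/

section AnyD

variable {D : ℕ} {F : Type*} [Fintype F]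

/-- [folklore] **THE RANK-ONE TADPOLE, HYPOTHESIS-FREE**: `tadpole A (φ ⊗ ψ) = tr (A ∘ (φ ⊗ ψ)) = ⟨A φ, ψ⟩`. -/
theorem tadpole_outer (A : MKer D F) (φ ψ : Site D → F → ℝ) : tadpole A (outer φ ψ) = pairing (applyK A φ) ψ := by
  unfold ExpKernelCalculus.tadpole
  rw [comp_outer_right, tr_outer]

end AnyD

/-! ## §3 `D = 4`: lattice gradients, bond indicators, and the gauge-term stencils `dSw (f ⊗ g)`, `dJetSw κ u Y` as rank-one kernels -/

/-- [our object] THE LATTICE GRADIENT of a site function as a bond function: `grad f (x,α) = f (x + e_α) − f x`. -/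
def grad (f : Site 4 → ℝ) : Site 4 → Fin 4 → ℝ := fun x α => f (x + unitVec α) - f x

/-- [our object] THE BOND INDICATOR `δ_{(u,κ)}`: `bondInd κ u (z,β) = [z = u ∧ β = κ]`. -/
def bondInd (κ : Fin 4) (u : Site 4) : Site 4 → Fin 4 → ℝ := fun z β => if z = u ∧ β = κ then 1 else 0

/-- [our object] THE TENSOR PRODUCT of two site functions as a `Unit`-fibred site kernel: `tensor f g x z = f x · g z`
(the entry function of `SbRblkAnatomy.dSw_rankOne`). -/
def tensor (f g : Site 4 → ℝ) : MKer 4 Unit := fun x z _ _ => f x * g z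

/-- [our object] THE COLUMN GRADIENT of a site kernel at a fixed column `q`: `colGrad Y q (x,α) = Y (x+e_α) q − Y x q`. -/
def colGrad (Y : MKer 4 Unit) (q : Site 4) : Site 4 → Fin 4 → ℝ := fun x α => Y (x + unitVec α) q () () - Y x q () ()

/-- [our object] THE ROW GRADIENT of a site kernel at a fixed row `p`: `rowGrad Y p (z,β) = Y p (z+e_β) − Y p z`. -/
def rowGrad (Y : MKer 4 Unit) (p : Site 4) : Site 4 → Fin 4 → ℝ := fun z β => Y p (z + unitVec β) () () - Y p z () ()

/-- [our object] Unfolding `grad`. -/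
theorem grad_apply (f : Site 4 → ℝ) (x : Site 4) (α : Fin 4) : grad f x α = f (x + unitVec α) - f x := rfl

/-- [our object] Unfolding `bondInd`. -/
theorem bondInd_apply (κ : Fin 4) (u z : Site 4) (β : Fin 4) : bondInd κ u z β = if z = u ∧ β = κ then 1 else 0 := rfl

/-- [our object] Unfolding `tensor`. -/
theorem tensor_apply (f g : Site 4 → ℝ) (x z : Site 4) (a b : Unit) : tensor f g x z a b = f x * g z := rfl

/-- [our object] `colGrad Y q = grad (x ↦ Y x q)`. -/
theorem colGrad_eq_grad (Y : MKer 4 Unit) (q : Site 4) : colGrad Y q = grad (fun x => Y x q () ()) := rfl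

/-- [our object] `rowGrad Y p = grad (z ↦ Y p z)`. -/
theorem rowGrad_eq_grad (Y : MKer 4 Unit) (p : Site 4) : rowGrad Y p = grad (fun z => Y p z () ()) := rfl

/-- [folklore] **`dSw` OF A TENSOR PRODUCT IS THE RANK-ONE KERNEL OF THE TWO GRADIENTS**: `dSw (f ⊗ g) = (∇f) ⊗ (∇g)`
(the kernel form of `SbRblkAnatomy.dSw_rankOne`). -/
theorem dSw_tensor (f g : Site 4 → ℝ) : dSw (tensor f g) = outer (grad f) (grad g) := by
  funext x z α β
  rw [dSw_apply]
  simp only [tensor, outer_apply, grad]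
  ring

/-- [folklore] **THE PROJECTOR-JET STENCIL AS A DIFFERENCE OF TWO RANK-ONE KERNELS**, one factor the bond indicator:
`dJetSw κ u Y = (colGrad Y (u+e_κ)) ⊗ δ_{(u,κ)} − δ_{(u,κ)} ⊗ (rowGrad Y (u+e_κ))` (THE CONVENTION of `RJetAssembly.dJetSw`). -/
theorem dJetSw_eq_outer_sub (κ : Fin 4) (u : Site 4) (Y : MKer 4 Unit) :
    dJetSw κ u Y = outer (colGrad Y (u + unitVec κ)) (bondInd κ u) - outer (bondInd κ u) (rowGrad Y (u + unitVec κ)) := by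
  funext x z α β
  rw [dJetSw_apply]
  simp only [Pi.sub_apply, outer_apply, colGrad, rowGrad, bondInd]
  split_ifs <;> ring

/-- [folklore] **PAIRING AGAINST THE BOND INDICATOR IS EVALUATION AT THE BOND** (left): `⟨δ_{(u,κ)}, χ⟩ = χ u κ`. -/
theorem pairing_bondInd_left (κ : Fin 4) (u : Site 4) (χ : Site 4 → Fin 4 → ℝ) : pairing (bondInd κ u) χ = χ u κ := by
  unfold pairing
  rw [tsum_eq_single u (fun x hx => Finset.sum_eq_zero fun a _ => by
    rw [bondInd_apply, if_neg (fun h => hx h.1), zero_mul])]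
  rw [Finset.sum_eq_single κ (fun a _ ha => by rw [bondInd_apply, if_neg (fun h => ha h.2), zero_mul])
    (fun h => absurd (Finset.mem_univ κ) h)]
  rw [bondInd_apply, if_pos ⟨rfl, rfl⟩, one_mul]

/-- [folklore] Pairing against the bond indicator is evaluation at the bond (right): `⟨χ, δ_{(u,κ)}⟩ = χ u κ`. -/
theorem pairing_bondInd_right (κ : Fin 4) (u : Site 4) (χ : Site 4 → Fin 4 → ℝ) : pairing χ (bondInd κ u) = χ u κ := by
  rw [pairing_comm, pairing_bondInd_left]

/-- [folklore] **A LEG ACTING ON THE BOND INDICATOR IS ITS COLUMN AT THE BOND**: `(A δ_{(u,κ)}) (x,a) = A x u a κ`. -/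
theorem applyK_bondInd (A : MKer 4 (Fin 4)) (κ : Fin 4) (u : Site 4) : applyK A (bondInd κ u) = fun x a => A x u a κ := by
  funext x a
  unfold applyK
  rw [tsum_eq_single u (fun y hy => Finset.sum_eq_zero fun b _ => by
    rw [bondInd_apply, if_neg (fun h => hy h.1), mul_zero])]
  rw [Finset.sum_eq_single κ (fun b _ hb => by rw [bondInd_apply, if_neg (fun h => hb h.2), mul_zero])
    (fun h => absurd (Finset.mem_univ κ) h)]
  rw [bondInd_apply, if_pos ⟨rfl, rfl⟩, mul_one]

/-- [folklore] **THE BOND INDICATOR ACTED ON FROM THE RIGHT IS THE ROW OF THE LEG AT THE BOND**: `(δ_{(u,κ)} A) (z,b) = A u z κ b`. -/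
theorem applyKT_bondInd (A : MKer 4 (Fin 4)) (κ : Fin 4) (u : Site 4) : applyKT (bondInd κ u) A = fun z b => A u z κ b := by
  funext z b
  unfold applyKT
  rw [tsum_eq_single u (fun y hy => Finset.sum_eq_zero fun a _ => by
    rw [bondInd_apply, if_neg (fun h => hy h.1), zero_mul])]
  rw [Finset.sum_eq_single κ (fun a _ ha => by rw [bondInd_apply, if_neg (fun h => ha h.2), zero_mul])
    (fun h => absurd (Finset.mem_univ κ) h)]
  rw [bondInd_apply, if_pos ⟨rfl, rfl⟩, one_mul]

/-- [folklore] `⟨ψ, A δ_{(u,κ)}⟩ = (ψ A)(u, κ)`: pairing a bond function with the column of the leg at the bond is the right action evaluated there. -/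
theorem pairing_applyK_bondInd (A : MKer 4 (Fin 4)) (ψ : Site 4 → Fin 4 → ℝ) (κ : Fin 4) (u : Site 4) :
    pairing ψ (applyK A (bondInd κ u)) = applyKT ψ A u κ := by
  rw [applyK_bondInd]; rfl

/-- [folklore] `⟨A δ_{(u,κ)}, ψ⟩ = (ψ A)(u, κ)` (the transposed placement). -/
theorem pairing_applyK_bondInd_left (A : MKer 4 (Fin 4)) (ψ : Site 4 → Fin 4 → ℝ) (κ : Fin 4) (u : Site 4) :
    pairing (applyK A (bondInd κ u)) ψ = applyKT ψ A u κ := by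
  rw [pairing_comm, pairing_applyK_bondInd]

/-- [folklore] The bond indicator is localised (centre `u`, constant `1`, rate `1`). -/
theorem locV_bondInd (κ : Fin 4) (u : Site 4) : LocV (bondInd κ u) := by
  refine ⟨u, 1, 1, one_pos, fun z β => ?_⟩
  by_cases h : z = u ∧ β = κ
  · rw [bondInd_apply, if_pos h, h.1, sub_self, GhostStencil.l1_zero]; simp
  · rw [bondInd_apply, if_neg h, abs_zero]; positivity

/-- [folklore] **THE GRADIENT OF A LOCALISED SITE FUNCTION IS A LOCALISED BOND FUNCTION** (`|x − p|₁ ≤ |x + e_α − p|₁ + 1` costs a factor `e^δ`). -/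
theorem locV_grad {f : Site 4 → ℝ} (hf : ∃ (p : Site 4) (C δ : ℝ), 0 < δ ∧ ∀ x, |f x| ≤ C * Real.exp (-δ * l1 (x - p))) :
    LocV (grad f) := by
  obtain ⟨p, C, δ, hδ, h⟩ := hf
  have hC : 0 ≤ C := by
    have := (abs_nonneg _).trans (h p)
    rw [sub_self, GhostStencil.l1_zero, mul_zero, Real.exp_zero, mul_one] at this
    exact this
  refine ⟨p, C * Real.exp δ + C, δ, hδ, fun x α => ?_⟩
  rw [grad_apply]
  have h1 := h (x + unitVec α)
  have h2 := h x
  have ht : l1 (x - p) ≤ l1 (x + unitVec α - p) + 1 := by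
    have := l1_sub_triangle x (x + unitVec α) p
    have hneg : l1 (x - (x + unitVec α)) = 1 := by
      rw [l1_sub_symm, add_sub_cancel_left, GhostStencil.l1_unitVec]
    linarith
  have hexp : Real.exp (-δ * l1 (x + unitVec α - p)) ≤ Real.exp δ * Real.exp (-δ * l1 (x - p)) := by
    rw [← Real.exp_add]
    exact Real.exp_le_exp.mpr (by nlinarith)
  calc |f (x + unitVec α) - f x| ≤ |f (x + unitVec α)| + |f x| := abs_sub _ _
    _ ≤ C * Real.exp (-δ * l1 (x + unitVec α - p)) + C * Real.exp (-δ * l1 (x - p)) := add_le_add h1 h2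
    _ ≤ C * (Real.exp δ * Real.exp (-δ * l1 (x - p))) + C * Real.exp (-δ * l1 (x - p)) :=
        add_le_add (mul_le_mul_of_nonneg_left hexp hC) le_rfl
    _ = (C * Real.exp δ + C) * Real.exp (-δ * l1 (x - p)) := by ring

/-- [folklore] A site function localised as a bond function (fibre-constant) gives the hypothesis shape of `locV_grad`. -/
theorem locV_grad_of_locV {f : Site 4 → ℝ} (hf : LocV (fun x (_ : Fin 4) => f x)) : LocV (grad f) := by
  obtain ⟨p, C, δ, hδ, h⟩ := hf
  exact locV_grad ⟨p, C, δ, hδ, fun x => h x 0⟩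

/-- [folklore] **THE COLUMN GRADIENT OF A SPREAD SITE KERNEL IS LOCALISED at the column.** -/
theorem locV_colGrad {Y : MKer 4 Unit} {C δ : ℝ} (hY : Decays Y C δ) (hδ : 0 < δ) (q : Site 4) : LocV (colGrad Y q) := by
  rw [colGrad_eq_grad]
  exact locV_grad ⟨q, C, δ, hδ, fun x => hY x q () ()⟩

/-- [folklore] **THE ROW GRADIENT OF A SPREAD SITE KERNEL IS LOCALISED at the row.** -/
theorem locV_rowGrad {Y : MKer 4 Unit} {C δ : ℝ} (hY : Decays Y C δ) (hδ : 0 < δ) (p : Site 4) : LocV (rowGrad Y p) := by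
  rw [rowGrad_eq_grad]
  exact locV_grad ⟨p, C, δ, hδ, fun z => by rw [l1_sub_symm]; exact hY p z () ()⟩

/-- [folklore] `dSw (f ⊗ g)` is a localised kernel when `f`, `g` are localised site functions. -/
theorem loc_dSw_tensor {f g : Site 4 → ℝ} (hf : LocV (fun x (_ : Fin 4) => f x)) (hg : LocV (fun x (_ : Fin 4) => g x)) :
    Loc (dSw (tensor f g)) := by
  rw [dSw_tensor]; exact loc_outer (locV_grad_of_locV hf) (locV_grad_of_locV hg)

/-! ## §4 The word shapes: `dSw ⊗ dSw`, `dSw ⊗ (indicator words)`, `dSw ⊗ dJetSw`, `dJetSw ⊗ dJetSw` -/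

/-- [folklore] **`dSw ⊗ dSw` (R2∕R3-type words), ANY two legs, NO hypothesis**:
`biBubble A (dSw (f⊗g)) B (dSw (f′⊗g′)) = ⟨∇g, B ∇f′⟩ · ⟨A ∇f, ∇g′⟩` — an3 §3′ (1) with `𝔅_A(h,f) = ⟨∇h, A∇f⟩`. -/
theorem biBubble_dSw_dSw (A B : MKer 4 (Fin 4)) (f g f' g' : Site 4 → ℝ) :
    biBubble A (dSw (tensor f g)) B (dSw (tensor f' g')) =
      pairing (grad g) (applyK B (grad f')) * pairing (applyK A (grad f)) (grad g') := by
  rw [dSw_tensor, dSw_tensor, biBubble_outer_outer]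

/-- [folklore] `dSw ⊗ dSw`, one leg: `bubble A (dSw (f⊗g)) (dSw (f′⊗g′)) = ⟨∇g, A ∇f′⟩ · ⟨A ∇f, ∇g′⟩`. -/
theorem bubble_dSw_dSw (A : MKer 4 (Fin 4)) (f g f' g' : Site 4 → ℝ) :
    bubble A (dSw (tensor f g)) (dSw (tensor f' g')) =
      pairing (grad g) (applyK A (grad f')) * pairing (applyK A (grad f)) (grad g') := by
  rw [bubble_eq_biBubble, biBubble_dSw_dSw]

/-- [folklore] **`dSw ⊗ (φ′ ⊗ δ_{(u,κ)})`** (the first term of a `dJetSw` partner): `= ⟨∇g, B φ′⟩ · (A ∇f)(u,κ)` — a POINT VALUE of `A∇f`. -/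
theorem biBubble_dSw_outer_bondInd_right (A B : MKer 4 (Fin 4)) (f g : Site 4 → ℝ) (φ' : Site 4 → Fin 4 → ℝ) (κ : Fin 4)
    (u : Site 4) :
    biBubble A (dSw (tensor f g)) B (outer φ' (bondInd κ u)) = pairing (grad g) (applyK B φ') * applyK A (grad f) u κ := by
  rw [dSw_tensor, biBubble_outer_outer, pairing_bondInd_right]

/-- [folklore] **`dSw ⊗ (δ_{(u,κ)} ⊗ ψ′)`** (the second term of a `dJetSw` partner): `= (∇g B)(u,κ) · ⟨A ∇f, ψ′⟩`. -/
theorem biBubble_dSw_outer_bondInd_left (A B : MKer 4 (Fin 4)) (f g : Site 4 → ℝ) (ψ' : Site 4 → Fin 4 → ℝ) (κ : Fin 4)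
    (u : Site 4) :
    biBubble A (dSw (tensor f g)) B (outer (bondInd κ u) ψ') = applyKT (grad g) B u κ * pairing (applyK A (grad f)) ψ' := by
  rw [dSw_tensor, biBubble_outer_outer, pairing_applyK_bondInd]

/-- [folklore] **`(φ ⊗ δ_{(u,κ)}) ⊗ (φ′ ⊗ δ_{(u′,κ′)})`**: `= (B φ′)(u,κ) · (A φ)(u′,κ′)` — two point values. -/
theorem biBubble_outer_bondInd_outer_bondInd (A B : MKer 4 (Fin 4)) (φ φ' : Site 4 → Fin 4 → ℝ) (κ κ' : Fin 4) (u u' : Site 4) :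
    biBubble A (outer φ (bondInd κ u)) B (outer φ' (bondInd κ' u')) = applyK B φ' u κ * applyK A φ u' κ' := by
  rw [biBubble_outer_outer, pairing_bondInd_left, pairing_bondInd_right]

/-- [folklore] **`(φ ⊗ δ_{(u,κ)}) ⊗ (δ_{(u′,κ′)} ⊗ ψ′)`**: `= B u u′ κ κ′ · ⟨A φ, ψ′⟩` — an ENTRY of the second leg. -/
theorem biBubble_outer_bondInd_bondInd_outer (A B : MKer 4 (Fin 4)) (φ ψ' : Site 4 → Fin 4 → ℝ) (κ κ' : Fin 4) (u u' : Site 4) :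
    biBubble A (outer φ (bondInd κ u)) B (outer (bondInd κ' u') ψ') = B u u' κ κ' * pairing (applyK A φ) ψ' := by
  rw [biBubble_outer_outer, applyK_bondInd, pairing_bondInd_left]

/-- [folklore] **`(δ_{(u,κ)} ⊗ ψ) ⊗ (φ′ ⊗ δ_{(u′,κ′)})`**: `= ⟨ψ, B φ′⟩ · A u′ u κ′ κ` — an ENTRY of the first leg. -/
theorem biBubble_bondInd_outer_outer_bondInd (A B : MKer 4 (Fin 4)) (ψ φ' : Site 4 → Fin 4 → ℝ) (κ κ' : Fin 4) (u u' : Site 4) :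
    biBubble A (outer (bondInd κ u) ψ) B (outer φ' (bondInd κ' u')) = pairing ψ (applyK B φ') * A u' u κ' κ := by
  rw [biBubble_outer_outer, applyK_bondInd, pairing_bondInd_right]

/-- [folklore] **`(δ_{(u,κ)} ⊗ ψ) ⊗ (δ_{(u′,κ′)} ⊗ ψ′)`**: `= (ψ B)(u′,κ′) · (ψ′ A)(u,κ)`. -/
theorem biBubble_bondInd_outer_bondInd_outer (A B : MKer 4 (Fin 4)) (ψ ψ' : Site 4 → Fin 4 → ℝ) (κ κ' : Fin 4) (u u' : Site 4) :
    biBubble A (outer (bondInd κ u) ψ) B (outer (bondInd κ' u') ψ') = applyKT ψ B u' κ' * applyKT ψ' A u κ := by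
  rw [biBubble_outer_outer, pairing_applyK_bondInd, pairing_applyK_bondInd_left]

/-- [folklore] **`dSw ⊗ dJetSw` (R2∕R3 ⊗ R1 words), ONE SPREAD LEG** (`Spr A`; the partner site kernel `Y` spread, `f`, `g` localised — so that the
difference in `dJetSw` splits by `bubble_sub_right`):
`bubble A (dSw (f⊗g)) (dJetSw κ u Y) = ⟨∇g, A ∇_col Y(·,u′)⟩·(A∇f)(u,κ) − (∇g A)(u,κ)·⟨A ∇f, ∇_row Y(u′,·)⟩`, `u′ = u + e_κ`. -/
theorem bubble_dSw_dJetSw {A : MKer 4 (Fin 4)} (hA : Spr A) {Y : MKer 4 Unit} (hY : Spr Y) {f g : Site 4 → ℝ}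
    (hf : LocV (fun x (_ : Fin 4) => f x)) (hg : LocV (fun x (_ : Fin 4) => g x)) (κ : Fin 4) (u : Site 4) :
    bubble A (dSw (tensor f g)) (dJetSw κ u Y) =
      pairing (grad g) (applyK A (colGrad Y (u + unitVec κ))) * applyK A (grad f) u κ
        - applyKT (grad g) A u κ * pairing (applyK A (grad f)) (rowGrad Y (u + unitVec κ)) := by
  obtain ⟨C, δ, hδ, hYd⟩ := hY
  rw [dJetSw_eq_outer_sub, bubble_outer_sub_right hA (loc_dSw_tensor hf hg) (locV_colGrad hYd hδ _) (locV_bondInd κ u)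
    (locV_bondInd κ u) (locV_rowGrad hYd hδ _), bubble_eq_biBubble, bubble_eq_biBubble, biBubble_dSw_outer_bondInd_right,
    biBubble_dSw_outer_bondInd_left]

/-- [folklore] **`dJetSw ⊗ dJetSw` (R1 ⊗ R1 words), ONE SPREAD LEG**: with `c = ∇_col Y(·,u⁺)`, `r = ∇_row Y(u⁺,·)`, `c′`, `r′` likewise for
`(κ′,u′,Y′)`:  `bubble A (dJetSw κ u Y) (dJetSw κ′ u′ Y′) = (A c′)(u,κ)·(A c)(u′,κ′) − A u u′ κ κ′·⟨A c, r′⟩ − ⟨r, A c′⟩·A u′ u κ′ κ + (r A)(u′,κ′)·(r′ A)(u,κ)`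
— two point values, one entry of the leg, two pairings: an3 §3′ (4) «R1⊗R1: `⟨e′,Ga g⟩⟨e,Ga g′⟩ − Ga(u′μ;uν)·⟨g,Ga g′⟩ − (transposes)`». -/
theorem bubble_dJetSw_dJetSw {A : MKer 4 (Fin 4)} (hA : Spr A) {Y Y' : MKer 4 Unit} (hY : Spr Y) (hY' : Spr Y') (κ κ' : Fin 4)
    (u u' : Site 4) :
    bubble A (dJetSw κ u Y) (dJetSw κ' u' Y') =
      applyK A (colGrad Y' (u' + unitVec κ')) u κ * applyK A (colGrad Y (u + unitVec κ)) u' κ'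
        - A u u' κ κ' * pairing (applyK A (colGrad Y (u + unitVec κ))) (rowGrad Y' (u' + unitVec κ'))
        - (pairing (rowGrad Y (u + unitVec κ)) (applyK A (colGrad Y' (u' + unitVec κ'))) * A u' u κ' κ
            - applyKT (rowGrad Y (u + unitVec κ)) A u' κ' * applyKT (rowGrad Y' (u' + unitVec κ')) A u κ) := by
  obtain ⟨C, δ, hδ, hYd⟩ := hY
  obtain ⟨C', δ', hδ', hYd'⟩ := hY'
  have h1 := locV_colGrad hYd hδ (u + unitVec κ)
  have h2 := locV_rowGrad hYd hδ (u + unitVec κ)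
  have h3 := locV_colGrad hYd' hδ' (u' + unitVec κ')
  have h4 := locV_rowGrad hYd' hδ' (u' + unitVec κ')
  have hb := locV_bondInd κ u
  have hb' := locV_bondInd κ' u'
  rw [dJetSw_eq_outer_sub, dJetSw_eq_outer_sub,
    bubble_outer_sub_left hA ((loc_outer h3 hb').sub (loc_outer hb' h4)) h1 hb hb h2,
    bubble_outer_sub_right hA (loc_outer h1 hb) h3 hb' hb' h4, bubble_outer_sub_right hA (loc_outer hb h2) h3 hb' hb' h4,
    bubble_eq_biBubble, bubble_eq_biBubble, bubble_eq_biBubble, bubble_eq_biBubble,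
    biBubble_outer_bondInd_outer_bondInd, biBubble_outer_bondInd_bondInd_outer, biBubble_bondInd_outer_outer_bondInd,
    biBubble_bondInd_outer_bondInd_outer]

end Summit.QuantumFields.BalabanUV.Beta.D1BFx.RankOneBubbleJets

end
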